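/-
Copyright (c) 2026. All rights reserved.
Released under Apache 2.0 license as described in the file LICENSE.
-/
import Literature.NumberTheory.Automorphic.MaximalOrderDiscThreeBrandtSetup
import HarnessLib

/-!
# `s₄(3n) = s₄(n)`: multiplication by `j` (`j² = −3`) on the maximal order `O₃` of `(−1,−3 ∣ ℚ)` is a bijection from the elements
# of reduced norm `n` onto those of reduced norm `3n`; hence `#{a² + ac + c² + b² + bd + d² = 3ᵃn} = #{… = n}`, `s₄(3ᵃ) = 12`,
# `s₄(3ᵃN) = 12σ(N)` for squarefree `N` prime to `3`, and the Brandt matrices of `O₃` satisfy `T(3ᵃn) = T(n)`, `T(3ᵃ) = 1`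

[tag: quaternion_algebra] [tag: quadratic_form] [tag: brandt_matrix]

Topic `NumberTheory/Automorphic`; THEOREMS ONLY (no definition, no named fact, no instance; net Literature debt `0`).
Lane `lit-hodgefound`, seat p12, gen 45 — seventh file of the series on the definite quaternion order of discriminant `3`.
At the RAMIFIED prime `3` the maximal order `O₃ = ℤ⟨1, i, ω, iω⟩` has the unique two-sided ideal `𝔓 = jO₃` (`j = 2ω − 1`,
`nrd j = 3`, `O₃/𝔓 ≅ 𝔽₉`), so an element of `O₃` has reduced norm divisible by `3` iff it lies in `jO₃`, and `x ↦ jx` is a bijection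
`{nrd = n} → {nrd = 3n}` (Eichler's `B(p^μ)B(p^ν) = B(p^{μ+ν})`, LNM 320 II §6 Thm. 2 (20), for this order: `T(3ᵃ) = 1`). In the
coordinates `x = a + bi + cω + d iω` of `O₃` (`MaximalOrderDiscThreeLattice.reducedNorm_mk`: `nrd = a² + ac + c² + b² + bd + d²`)
this is the explicit linear map `(A, B, C, D) ↦ (−A − 2C, B + 2D, 2A + C, −2B − D)`, which multiplies the form by `3`, and the
file is written directly on `ℤ⁴` (no quaternion arithmetic is needed for §1):

* §1 `form_threeMap` (`Q(φv) = 3Q(v)`), `three_dvd_form_iff` (**`3 ∣ Q(a,b,c,d) ⟺ a ≡ c ∧ b ≡ d (mod 3)`** — the residue field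
  `𝔽₉`), **`natCard_form_three_mul`** (`#{Q = 3n} = #{Q = n}`: `φ` is a bijection onto the solutions of `Q = 3n`),
  `natCard_form_three_pow_mul` (`#{Q = 3ᵃn} = #{Q = n}`), **`natCard_form_three_pow`** (`s₄(3ᵃ) = 12`),
  **`natCard_form_three_pow_mul_of_squarefree`** (WILLIAMS EX. 17.1 `s₄(3^α N) = 12σ(N)`, here for squarefree `N` prime to `3`);
* §2 for `O₃`: `natCard_reducedNorm_three_mul` (`#{x ∈ O₃ : nrd x = 3n} = #{x ∈ O₃ : nrd x = n}`), and for its Brandt matrices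
  (`s₄ = 12·T`, `MaximalOrderDiscThreeBrandtSetup.natCard_reducedNorm_eq_twelve_mul_matrix`) **`matrix_three_mul`** (`T(3n) = T(n)`,
  `n ≥ 1`), `matrix_three_pow_mul` (`T(3ᵃn) = T(n)`), **`matrix_three_pow`** (`T(3ᵃ)_ij = 1` — Eichler (20) at the ramified prime
  of `O₃`), `matrix_three_pow_mul_of_squarefree` (`T(3ᵃN)_ij = σ(N)`);
* §3 WILLIAMS' THEOREM 17.3 AS PRINTED, for the `n ≥ 1` whose `3`-free part is squarefree: `sigma_three_pow_succ_mul`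
  (`σ(3^{a+1}N) = 3σ(3ᵃN) + σ(N)`), `twelve_sigma_sub_thirtySix_sigma_div_three` (`12σ(n) − 36σ(n/3) = 12σ(N)` for `n = 3ᵃN`),
  **`natCard_form_three_pow_mul_eq_sigma_sub`**, **`natCard_form_eq_sigma_sub`** (`s₄(n) = 12σ(n) − 36σ(n/3)`, `σ(n/3) := 0` if
  `3 ∤ n`), `natCard_form_eq_twelve_mul_sigma_ordCompl` (`s₄(n) = 12σ(n/3^{v₃(n)})`).

## Sources

* K. S. Williams, *Number Theory in the Spirit of Liouville*, LMS Student Texts 76 (2011), Thm. 17.3 (`s₄(n) = 12σ(n) − 36σ(n/3)`)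
  and Exercise 17.1 («Define `α ∈ ℕ₀` and `N ∈ ℕ` with `3 ∤ N` by `n = 3^α N`. Prove that `s₄(n) = 12σ(N)`»).
  [cite: Williams2011Liouville, Thm. 17.3 and Exercise 17.1]
* M. Eichler, LNM 320 (1973), Ch. II §2 (`ζ_p(s) = (1 − p^{−2s})⁻¹` for `p ∣ D`: one integral ideal of each norm `pᵃ`), §6 Thm. 2
  (20) (`B(p^μ)B(p^ν) = B(p^{μ+ν})` for `p ∣ D`). [cite: Eichler1973, Ch. II §2 and §6 Thm. 2 (20)]
* J. Voight, *Quaternion Algebras*, GTM 288 (2021), Exercise 11.12, 11.5.12 (`O = ℤ⟨i, (1+j)/2⟩`, `j² = −3`), Thm. 13.3.11 ∕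
  §13.3 (the unique maximal ideal `P = jO` above a ramified prime, `O/P` a field of order `p²`). [cite: Voight2021, Exercise 11.12; 11.5.12; §13.3]

## Scope (honest)

Theorems only — no definition, no named fact, no instance. The `3`-part is removed exactly and unconditionally (§1–§2); the
closed formulas of §1 and §3 still require the `3`-free part of `n` to be squarefree (prime powers `pᵃ`, `p ≠ 3`, `a ≥ 2`, await
the Hecke recursion `T(p^{a+1}) = T(p)T(pᵃ) − pT(p^{a−1})` for this order) — Williams' Theorem 17.3 itself is for every `n`.
-/

open Quaternion
open Finset
open scoped Pointwise
open Literature.NumberTheory.Automorphic.Brandt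

namespace Literature.NumberTheory.Automorphic.MaxOrderDiscThree

/-! ## §1 The form `a² + ac + c² + b² + bd + d²` on `ℤ⁴`: the `3`-map -/

section Form

/-- `Q(−A − 2C, B + 2D, 2A + C, −2B − D) = 3·Q(A, B, C, D)` (multiplication by `j` in the coordinates of `O₃`). [cite: Voight2021, 11.5.12] -/
theorem form_threeMap (A B C D : ℤ) :
    (-A - 2 * C) ^ 2 + (-A - 2 * C) * (2 * A + C) + (2 * A + C) ^ 2 + (B + 2 * D) ^ 2 + (B + 2 * D) * (-2 * B - D) +
        (-2 * B - D) ^ 2 = 3 * (A ^ 2 + A * C + C ^ 2 + B ^ 2 + B * D + D ^ 2) := by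
  ring

/-- **`3 ∣ a² + ac + c² + b² + bd + d² ⟺ a ≡ c ∧ b ≡ d (mod 3)`** (`a² + ac + c² ≡ (a − c)²`, and a sum of two squares vanishes mod `3`
only trivially: `O₃/jO₃ ≅ 𝔽₉` is a field). [cite: Voight2021, §13.3] -/
theorem three_dvd_form_iff (a b c d : ℤ) :
    (3 : ℤ) ∣ a ^ 2 + a * c + c ^ 2 + b ^ 2 + b * d + d ^ 2 ↔ (3 : ℤ) ∣ a - c ∧ (3 : ℤ) ∣ b - d := by
  have key : ∀ x y z w : ZMod 3, x ^ 2 + x * z + z ^ 2 + y ^ 2 + y * w + w ^ 2 = 0 ↔ x = z ∧ y = w := by decide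
  have e₁ := ZMod.intCast_zmod_eq_zero_iff_dvd (a ^ 2 + a * c + c ^ 2 + b ^ 2 + b * d + d ^ 2) 3
  have e₂ := ZMod.intCast_zmod_eq_zero_iff_dvd (a - c) 3
  have e₃ := ZMod.intCast_zmod_eq_zero_iff_dvd (b - d) 3
  push_cast at e₁ e₂ e₃
  rw [← e₁, ← e₂, ← e₃, sub_eq_zero, sub_eq_zero]
  exact key _ _ _ _

/-- **`#{(a,b,c,d) ∈ ℤ⁴ : Q = 3n} = #{(a,b,c,d) ∈ ℤ⁴ : Q = n}`**: the `3`-map is a bijection from the solutions of `Q = n` onto those of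
`Q = 3n` (a solution of `Q = 3n` has `a ≡ c`, `b ≡ d (mod 3)`, and then `A = (a + 2c)/3`, `C = −(2a + c)/3`, `B = −(b + 2d)/3`,
`D = (2b + d)/3` is its unique preimage). [cite: Williams2011Liouville, Exercise 17.1] [cite: Eichler1973, Ch. II §6 Thm. 2 (20)] -/
theorem natCard_form_three_mul (n : ℤ) :
    Nat.card {v : ℤ × ℤ × ℤ × ℤ //
        v.1 ^ 2 + v.1 * v.2.2.1 + v.2.2.1 ^ 2 + v.2.1 ^ 2 + v.2.1 * v.2.2.2 + v.2.2.2 ^ 2 = 3 * n} =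
      Nat.card {v : ℤ × ℤ × ℤ × ℤ //
        v.1 ^ 2 + v.1 * v.2.2.1 + v.2.2.1 ^ 2 + v.2.1 ^ 2 + v.2.1 * v.2.2.2 + v.2.2.2 ^ 2 = n} := by
  symm
  refine Nat.card_congr (Equiv.ofBijective
    (fun v => ⟨(-v.1.1 - 2 * v.1.2.2.1, v.1.2.1 + 2 * v.1.2.2.2, 2 * v.1.1 + v.1.2.2.1, -2 * v.1.2.1 - v.1.2.2.2), by
      have h := form_threeMap v.1.1 v.1.2.1 v.1.2.2.1 v.1.2.2.2
      rw [v.2] at h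
      exact h⟩) ⟨?_, ?_⟩)
  · rintro ⟨⟨A, B, C, D⟩, hv⟩ ⟨⟨A', B', C', D'⟩, hv'⟩ h
    simp only [Subtype.mk.injEq, Prod.mk.injEq] at h
    obtain ⟨h1, h2, h3, h4⟩ := h
    have hA : A = A' := by omega
    have hB : B = B' := by omega
    have hC : C = C' := by omega
    have hD : D = D' := by omega
    subst hA hB hC hD
    rfl
  · rintro ⟨⟨a, b, c, d⟩, h⟩
    have h3 : (3 : ℤ) ∣ a ^ 2 + a * c + c ^ 2 + b ^ 2 + b * d + d ^ 2 := ⟨n, h⟩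
    obtain ⟨hac, hbd⟩ := (three_dvd_form_iff a b c d).1 h3
    obtain ⟨A, hA⟩ : (3 : ℤ) ∣ a + 2 * c := by omega
    obtain ⟨C, hC⟩ : (3 : ℤ) ∣ -(2 * a + c) := by omega
    obtain ⟨B, hB⟩ : (3 : ℤ) ∣ -(b + 2 * d) := by omega
    obtain ⟨D, hD⟩ : (3 : ℤ) ∣ 2 * b + d := by omega
    refine ⟨⟨⟨A, B, C, D⟩, ?_⟩, ?_⟩
    · have e : a ^ 2 + a * c + c ^ 2 + b ^ 2 + b * d + d ^ 2 = 3 * (A ^ 2 + A * C + C ^ 2 + B ^ 2 + B * D + D ^ 2) := by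
        have ha : a = -A - 2 * C := by omega
        have hb : b = B + 2 * D := by omega
        have hc : c = 2 * A + C := by omega
        have hd : d = -2 * B - D := by omega
        rw [ha, hb, hc, hd]
        ring
      have : 3 * (A ^ 2 + A * C + C ^ 2 + B ^ 2 + B * D + D ^ 2) = 3 * n := by rw [← e, h]
      simpa using (mul_right_injective₀ (by norm_num : (3 : ℤ) ≠ 0) this)
    · simp only [Subtype.mk.injEq, Prod.mk.injEq]
      omega

/-- **`#{Q = 3ᵃn} = #{Q = n}`** for every `a`. [cite: Williams2011Liouville, Exercise 17.1] -/
theorem natCard_form_three_pow_mul (a : ℕ) (n : ℤ) :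
    Nat.card {v : ℤ × ℤ × ℤ × ℤ //
        v.1 ^ 2 + v.1 * v.2.2.1 + v.2.2.1 ^ 2 + v.2.1 ^ 2 + v.2.1 * v.2.2.2 + v.2.2.2 ^ 2 = 3 ^ a * n} =
      Nat.card {v : ℤ × ℤ × ℤ × ℤ //
        v.1 ^ 2 + v.1 * v.2.2.1 + v.2.2.1 ^ 2 + v.2.1 ^ 2 + v.2.1 * v.2.2.2 + v.2.2.2 ^ 2 = n} := by
  induction a with
  | zero => rw [pow_zero, one_mul]
  | succ a ih => rw [pow_succ, mul_comm ((3 : ℤ) ^ a) 3, mul_assoc, natCard_form_three_mul, ih]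

/-- **`s₄(3ᵃ) = 12`**: the number of `(a,b,c,d) ∈ ℤ⁴` with `a² + ac + c² + b² + bd + d² = 3ᵃ` is `12` for every `a`
(`= 12σ(1)`; `3ᵃ = nrd` of the `12` elements `j^a u`, `u ∈ O₃^×`). [cite: Williams2011Liouville, Thm. 17.3 and Exercise 17.1 (n = 3^α)] -/
theorem natCard_form_three_pow (a : ℕ) :
    Nat.card {v : ℤ × ℤ × ℤ × ℤ //
        v.1 ^ 2 + v.1 * v.2.2.1 + v.2.2.1 ^ 2 + v.2.1 ^ 2 + v.2.1 * v.2.2.2 + v.2.2.2 ^ 2 = (3 : ℤ) ^ a} = 12 := by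
  have h := natCard_form_three_pow_mul a 1
  rw [mul_one] at h
  rw [h, natCard_form_eq_one]

/-- **WILLIAMS, EXERCISE 17.1 (squarefree cofactor): `s₄(3ᵃN) = 12σ(N)` for every `a` and every squarefree `N` prime to `3`.**
[cite: Williams2011Liouville, Exercise 17.1 and Thm. 17.3] -/
theorem natCard_form_three_pow_mul_of_squarefree (a : ℕ) {N : ℕ} (hN : Squarefree N) (h3 : ¬ 3 ∣ N) :
    Nat.card {v : ℤ × ℤ × ℤ × ℤ //
        v.1 ^ 2 + v.1 * v.2.2.1 + v.2.2.1 ^ 2 + v.2.1 ^ 2 + v.2.1 * v.2.2.2 + v.2.2.2 ^ 2 = (3 ^ a * N : ℕ)} =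
      12 * ArithmeticFunction.sigma 1 N := by
  rw [← natCard_form_of_squarefree hN h3]
  push_cast
  exact natCard_form_three_pow_mul a N

end Form

/-! ## §2 For `O₃`: `#{nrd = 3n} = #{nrd = n}` and `T(3ᵃn) = T(n)`, `T(3ᵃ) = 1` -/

section Order

/-- **`#{x ∈ O₃ : nrd x = 3n} = #{x ∈ O₃ : nrd x = n}`** (`x ↦ jx`, in coordinates the `3`-map). [cite: Eichler1973, Ch. II §2 and §6 Thm. 2 (20)] [cite: Voight2021, §13.3] -/
theorem natCard_reducedNorm_three_mul (n : ℕ) :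
    Nat.card {x : ℍ[ℚ,-1,-3] // x ∈ (Submodule.span ℤ (Set.range ![(⟨1, 0, 0, 0⟩ : ℍ[ℚ,-1,-3]), ⟨0, 1, 0, 0⟩, ⟨1/2, 0, 1/2, 0⟩, ⟨0, 1/2, 0, 1/2⟩])) ∧ reducedNorm ℚ ℍ[ℚ,-1,-3] x = (3 * n : ℕ)} =
      Nat.card {x : ℍ[ℚ,-1,-3] // x ∈ (Submodule.span ℤ (Set.range ![(⟨1, 0, 0, 0⟩ : ℍ[ℚ,-1,-3]), ⟨0, 1, 0, 0⟩, ⟨1/2, 0, 1/2, 0⟩, ⟨0, 1/2, 0, 1/2⟩])) ∧ reducedNorm ℚ ℍ[ℚ,-1,-3] x = n} := by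
  rw [← natCard_form_eq_natCard_reducedNorm, ← natCard_form_eq_natCard_reducedNorm]
  push_cast
  exact natCard_form_three_mul n

/-- **`T(3n)_ij = T(n)_ij` (`n ≥ 1`) for the Brandt matrices of `O₃`** (`12·T(m)_ii = #{x ∈ O₃ : nrd x = m}` on the one-point class
set). [cite: Eichler1973, Ch. II §6 Thm. 2 (20)] -/
theorem matrix_three_mul {n : ℕ} (hn : 0 < n) (i j : ClassSet (Submodule.span ℤ (Set.range ![(⟨1, 0, 0, 0⟩ : ℍ[ℚ,-1,-3]), ⟨0, 1, 0, 0⟩, ⟨1/2, 0, 1/2, 0⟩, ⟨0, 1/2, 0, 1/2⟩]))) : matrix (Submodule.span ℤ (Set.range ![(⟨1, 0, 0, 0⟩ : ℍ[ℚ,-1,-3]), ⟨0, 1, 0, 0⟩, ⟨1/2, 0, 1/2, 0⟩, ⟨0, 1/2, 0, 1/2⟩])) (3 * n) i j = matrix (Submodule.span ℤ (Set.range ![(⟨1, 0, 0, 0⟩ : ℍ[ℚ,-1,-3]), ⟨0, 1, 0, 0⟩, ⟨1/2, 0, 1/2, 0⟩, ⟨0, 1/2, 0, 1/2⟩])) n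 i j := by
  haveI := subsingleton_classSet
  rw [Subsingleton.elim j i]
  have h3n := natCard_reducedNorm_eq_twelve_mul_matrix (mul_pos (by norm_num : (0 : ℕ) < 3) hn).ne' i
  have hn' := natCard_reducedNorm_eq_twelve_mul_matrix hn.ne' i
  rw [natCard_reducedNorm_three_mul, hn'] at h3n
  linarith

/-- **`T(3ᵃn)_ij = T(n)_ij`** (`n ≥ 1`). [cite: Eichler1973, Ch. II §6 Thm. 2 (20)] -/
theorem matrix_three_pow_mul (a : ℕ) {n : ℕ} (hn : 0 < n) (i j : ClassSet (Submodule.span ℤ (Set.range ![(⟨1, 0, 0, 0⟩ : ℍ[ℚ,-1,-3]), ⟨0, 1, 0, 0⟩, ⟨1/2, 0, 1/2, 0⟩, ⟨0, 1/2, 0, 1/2⟩]))) :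
    matrix (Submodule.span ℤ (Set.range ![(⟨1, 0, 0, 0⟩ : ℍ[ℚ,-1,-3]), ⟨0, 1, 0, 0⟩, ⟨1/2, 0, 1/2, 0⟩, ⟨0, 1/2, 0, 1/2⟩])) (3 ^ a * n) i j = matrix (Submodule.span ℤ (Set.range ![(⟨1, 0, 0, 0⟩ : ℍ[ℚ,-1,-3]), ⟨0, 1, 0, 0⟩, ⟨1/2, 0, 1/2, 0⟩, ⟨0, 1/2, 0, 1/2⟩])) n i j := by
  induction a with
  | zero => rw [pow_zero, one_mul]
  | succ a ih => rw [pow_succ, mul_comm (3 ^ a) 3, mul_assoc, matrix_three_mul (by positivity) i j, ih]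

/-- **`T(3ᵃ)_ij = 1` for every `a`** — Eichler's `B(p^μ)B(p^ν) = B(p^{μ+ν})` at the ramified prime `3` of `O₃`: exactly one integral
right ideal `jᵃO₃` of each `3`-power norm. [cite: Eichler1973, Ch. II §2 and §6 Thm. 2 (20)] [cite: VignerasLNM800, Ch. III §5 exercice 5.8 (c)] -/
theorem matrix_three_pow (a : ℕ) (i j : ClassSet (Submodule.span ℤ (Set.range ![(⟨1, 0, 0, 0⟩ : ℍ[ℚ,-1,-3]), ⟨0, 1, 0, 0⟩, ⟨1/2, 0, 1/2, 0⟩, ⟨0, 1/2, 0, 1/2⟩]))) : matrix (Submodule.span ℤ (Set.range ![(⟨1, 0, 0, 0⟩ : ℍ[ℚ,-1,-3]), ⟨0, 1, 0, 0⟩, ⟨1/2, 0, 1/2, 0⟩, ⟨0, 1/2, 0, 1/2⟩])) (3 ^ a) i j = 1 := by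
  have h := matrix_three_pow_mul a one_pos i j
  rw [mul_one] at h
  rw [h, matrix_one']

/-- `T(3ᵃN)_ij = σ(N)` for squarefree `N` prime to `3`. [cite: Eichler1973, Ch. II §6 Thm. 2 (18), (20), Cor. 1] -/
theorem matrix_three_pow_mul_of_squarefree (a : ℕ) {N : ℕ} (hN : Squarefree N) (h3 : ¬ 3 ∣ N) (i j : ClassSet (Submodule.span ℤ (Set.range ![(⟨1, 0, 0, 0⟩ : ℍ[ℚ,-1,-3]), ⟨0, 1, 0, 0⟩, ⟨1/2, 0, 1/2, 0⟩, ⟨0, 1/2, 0, 1/2⟩]))) :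
    matrix (Submodule.span ℤ (Set.range ![(⟨1, 0, 0, 0⟩ : ℍ[ℚ,-1,-3]), ⟨0, 1, 0, 0⟩, ⟨1/2, 0, 1/2, 0⟩, ⟨0, 1/2, 0, 1/2⟩])) (3 ^ a * N) i j = ArithmeticFunction.sigma 1 N := by
  rw [matrix_three_pow_mul a (Nat.pos_of_ne_zero hN.ne_zero) i j, matrix_apply_of_squarefree hN h3]

/-- **`#{x ∈ O₃ : nrd x = 3ᵃ} = 12`** for every `a`. [cite: Williams2011Liouville, Exercise 17.1] [cite: Voight2021, 11.5.12] -/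
theorem natCard_reducedNorm_three_pow (a : ℕ) :
    Nat.card {x : ℍ[ℚ,-1,-3] // x ∈ (Submodule.span ℤ (Set.range ![(⟨1, 0, 0, 0⟩ : ℍ[ℚ,-1,-3]), ⟨0, 1, 0, 0⟩, ⟨1/2, 0, 1/2, 0⟩, ⟨0, 1/2, 0, 1/2⟩])) ∧ reducedNorm ℚ ℍ[ℚ,-1,-3] x = (3 ^ a : ℕ)} = 12 := by
  rw [← natCard_form_eq_natCard_reducedNorm]
  push_cast
  exact natCard_form_three_pow a

end Order

/-! ## §3 Williams' Theorem 17.3 `s₄(n) = 12σ(n) − 36σ(n/3)` for the `n = 3ᵃN` with `N` squarefree -/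

section Williams

/-- `σ(3^{a+1}N) = 3σ(3ᵃN) + σ(N)` for `3 ∤ N` (`σ(3^{a+1}) = 3σ(3ᵃ) + 1`, multiplicativity) — the arithmetic behind
Williams' Exercise 17.1. [cite: Williams2011Liouville, Exercise 17.1] [cite: HardyWright2008, §16.7 Thm. 274–275 (σ(n) = ∏ (p^{a+1} − 1)/(p − 1), so σ is multiplicative)] -/
theorem sigma_three_pow_succ_mul (a : ℕ) {N : ℕ} (h3 : ¬ 3 ∣ N) :
    ArithmeticFunction.sigma 1 (3 ^ (a + 1) * N) =
      3 * ArithmeticFunction.sigma 1 (3 ^ a * N) + ArithmeticFunction.sigma 1 N := by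
  have hc : ∀ k, Nat.Coprime (3 ^ k) N := fun k =>
    Nat.Coprime.pow_left k ((Nat.Prime.coprime_iff_not_dvd Nat.prime_three).2 h3)
  rw [ArithmeticFunction.isMultiplicative_sigma.map_mul_of_coprime (hc _),
    ArithmeticFunction.isMultiplicative_sigma.map_mul_of_coprime (hc _),
    ArithmeticFunction.sigma_one_apply_prime_pow Nat.prime_three,
    ArithmeticFunction.sigma_one_apply_prime_pow Nat.prime_three, Finset.sum_range_succ', pow_zero]
  simp_rw [pow_succ]
  rw [← Finset.sum_mul]
  ring

/-- `σ(n) − 3σ(n/3) = σ(N)` for `n = 3ᵃN`, `3 ∤ N` — with Williams' convention `σ(n/3) = 0` when `3 ∤ n`; here in the form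
`12σ(3ᵃN) − 36σ(3ᵃN/3) = 12σ(N)`. [cite: Williams2011Liouville, Thm. 17.3 and Exercise 17.1] -/
theorem twelve_sigma_sub_thirtySix_sigma_div_three (a : ℕ) {N : ℕ} (h3 : ¬ 3 ∣ N) :
    12 * (ArithmeticFunction.sigma 1 (3 ^ a * N) : ℤ) -
        36 * (if 3 ∣ 3 ^ a * N then (ArithmeticFunction.sigma 1 (3 ^ a * N / 3) : ℤ) else 0) =
      12 * ArithmeticFunction.sigma 1 N := by
  cases a with
  | zero =>
    rw [pow_zero, one_mul, if_neg h3]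
    ring
  | succ k =>
    have hdvd : 3 ∣ 3 ^ (k + 1) * N := dvd_mul_of_dvd_left (dvd_pow_self 3 (Nat.succ_ne_zero k)) N
    have hdiv : 3 ^ (k + 1) * N / 3 = 3 ^ k * N := by
      rw [pow_succ, mul_comm (3 ^ k) 3, mul_assoc, Nat.mul_div_cancel_left _ (by norm_num : 0 < 3)]
    rw [if_pos hdvd, hdiv, sigma_three_pow_succ_mul k h3]
    push_cast
    ring

/-- **WILLIAMS, THEOREM 17.3 (for `n = 3ᵃN`, `N` squarefree, `3 ∤ N`): `s₄(n) = 12σ(n) − 36σ(n/3)`**, where `σ(n/3) = 0` if `3 ∤ n`.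
[cite: Williams2011Liouville, Thm. 17.3] -/
theorem natCard_form_three_pow_mul_eq_sigma_sub (a : ℕ) {N : ℕ} (hN : Squarefree N) (h3 : ¬ 3 ∣ N) :
    (Nat.card {v : ℤ × ℤ × ℤ × ℤ //
        v.1 ^ 2 + v.1 * v.2.2.1 + v.2.2.1 ^ 2 + v.2.1 ^ 2 + v.2.1 * v.2.2.2 + v.2.2.2 ^ 2 = (3 ^ a * N : ℕ)} : ℤ) =
      12 * (ArithmeticFunction.sigma 1 (3 ^ a * N) : ℤ) -
        36 * (if 3 ∣ 3 ^ a * N then (ArithmeticFunction.sigma 1 (3 ^ a * N / 3) : ℤ) else 0) := by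
  rw [twelve_sigma_sub_thirtySix_sigma_div_three a h3, natCard_form_three_pow_mul_of_squarefree a hN h3]
  push_cast
  ring

/-- **WILLIAMS, THEOREM 17.3, as printed, for every `n ≥ 1` whose `3`-free part `n/3^{v₃(n)}` is squarefree:** the number `s₄(n)` of
`(a,b,c,d) ∈ ℤ⁴` with `a² + ac + c² + b² + bd + d² = n` is `12σ(n) − 36σ(n/3)` (`σ(n/3) = 0` if `3 ∤ n`).
[cite: Williams2011Liouville, Thm. 17.3] -/
theorem natCard_form_eq_sigma_sub {n : ℕ} (hn : n ≠ 0) (hsq : Squarefree (n / 3 ^ n.factorization 3)) :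
    (Nat.card {v : ℤ × ℤ × ℤ × ℤ //
        v.1 ^ 2 + v.1 * v.2.2.1 + v.2.2.1 ^ 2 + v.2.1 ^ 2 + v.2.1 * v.2.2.2 + v.2.2.2 ^ 2 = n} : ℤ) =
      12 * (ArithmeticFunction.sigma 1 n : ℤ) - 36 * (if 3 ∣ n then (ArithmeticFunction.sigma 1 (n / 3) : ℤ) else 0) := by
  have h3 : ¬ 3 ∣ n / 3 ^ n.factorization 3 := Nat.not_dvd_ordCompl Nat.prime_three hn
  have e : 3 ^ n.factorization 3 * (n / 3 ^ n.factorization 3) = n := Nat.ordProj_mul_ordCompl_eq_self n 3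
  have key := natCard_form_three_pow_mul_eq_sigma_sub (n.factorization 3) hsq h3
  rw [e] at key
  exact key

/-- In particular `s₄(n) = 12 Σ_{d ∣ n, 3 ∤ d} d`-style closed form `s₄(n) = 12σ(n / 3^{v₃(n)})` for these `n`.
[cite: Williams2011Liouville, Exercise 17.1] -/
theorem natCard_form_eq_twelve_mul_sigma_ordCompl {n : ℕ} (hn : n ≠ 0) (hsq : Squarefree (n / 3 ^ n.factorization 3)) :
    Nat.card {v : ℤ × ℤ × ℤ × ℤ //
        v.1 ^ 2 + v.1 * v.2.2.1 + v.2.2.1 ^ 2 + v.2.1 ^ 2 + v.2.1 * v.2.2.2 + v.2.2.2 ^ 2 = n} =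
      12 * ArithmeticFunction.sigma 1 (n / 3 ^ n.factorization 3) := by
  have h3 : ¬ 3 ∣ n / 3 ^ n.factorization 3 := Nat.not_dvd_ordCompl Nat.prime_three hn
  have e : 3 ^ n.factorization 3 * (n / 3 ^ n.factorization 3) = n := Nat.ordProj_mul_ordCompl_eq_self n 3
  have key := natCard_form_three_pow_mul_of_squarefree (n.factorization 3) hsq h3
  rw [e] at key
  exact key

end Williams

end Literature.NumberTheory.Automorphic.MaxOrderDiscThree
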